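import Literature.Probability.Percolation.AltFourArmStability
import Literature.Probability.Percolation.AltFourArmLowerBound
import HarnessLib

/-!
# Werner's Lemma 6.3 for the alternating `π̂` from alternating separation ALONE (proofs only)

Topic `Literature/Probability/Percolation`; family `crit-perc`. PROOFS ONLY (no definition, no
named fact). Serves the named fact `Literature.Probability.Percolation.Werner2009_lemma63`
(W. Werner, *Lectures on two-dimensional critical percolation*, IAS/Park City Math. Ser. 16
(2009), Lecture 6, Lemma 6.3: "`π̂_p(n) ≍ π̂(n)` for `n ≤ L(p)`"; P. Nolin, EJP 13 (2008), Thm. 27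
for `j = 4` [arXiv 0711.4948: Thm. 26]).

`AltFourArmStability.lean` proves Lemma 6.3 for Werner's own ALTERNATING `π̂`
(`altFourArmProbAt`) from two displayed inputs, `hsepA` (near-critical separation of four
alternating arms below `L(t, ε)`, Nolin's Thm. 11 for `σ = BWBW`) and `hLB` (the a priori lower
bound `c (m/n)^{2-β} ≤ π̂^alt_t(m, n)` below `L(t, ε)`, Werner Lecture 6, §3, third estimate).
The second input is now a THEOREM of the tree, `altFourArm_lowerBound`
(`AltFourArmLowerBound.lean`, separation-free: five arms around the lowest crossing and Reimer's
inequality). This file records the resulting one-input forms: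

* `altFourArm_stability_of_altSeparation'` — Lemma 6.3 for `π̂^alt` from `hsepA` alone;
* `Werner2009_lemma63_of_altSeparation_of_adjStability` — the tree's ORDER-FREE named fact
  `Werner2009_lemma63` (`π̂_t = fourArmProbAt t r₀ N = P_t(armEvent ![T,F,T,F] r₀ N)`, both cyclic
  arrangements) from `hsepA` and the near-critical stability of the ADJACENT arrangement
  `adjFourArm` (Nolin's Thm. 27 for `σ = BBWW`, the Case 3 of its proof), by the union bound of
  `Werner2009_lemma63_of_altStability_of_adjStability` (no colour switching);
(From `hsepA` and the near-critical bridge `c π̂_t ≤ π̂^alt_t` the fact is already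
`Werner2009_lemma63_of_altSeparation_of_bridge`, `FourArmStabilityFromAltPattern.lean`.)

What remains displayed for the order-free fact is therefore exactly Nolin's Thm. 11 for
`σ = BWBW` below `L(p)` (`hsepA`) together with ONE statement about the adjacent arrangement below
`L(p)` (its stability, or the bridge) — Nolin's Thm. 27 / Thm. 11 for `σ = BBWW`.

## References

* W. Werner, *Lectures on two-dimensional critical percolation*, IAS/Park City Math. Ser. 16
  (2009), Lecture 6, Lemma 6.3, §3 (a priori estimates) and §5 [WernerPCMI2009].
* P. Nolin, Near-critical percolation in two dimensions, *Electron. J. Probab.* 13 (2008),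
  Thm. 11, Thm. 24 (ii), §6.2 Thm. 27 (arXiv 0711.4948: Thm. 10, Thm. 23 (ii), Thm. 26)
  [Nolin2008].
* H. Kesten, Scaling relations for 2D-percolation, *Comm. Math. Phys.* 109 (1987) [KestenScalingCMP1987].

## Mathlib / tree

Tree: `altFourArm_stability_of_altSeparation`,
`Werner2009_lemma63_of_altSeparation_of_lowerBound_of_bridge` (`AltFourArmStability.lean`),
`altFourArm_lowerBound` (`AltFourArmLowerBound.lean`),
`Werner2009_lemma63_of_altStability_of_adjStability`, `Werner2009_lemma63_of_altStability_of_bridge`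
(`FourArmStabilityFromAltPattern.lean`).
-/

noncomputable section

open MeasureTheory unitInterval Set

namespace Literature.Probability.Percolation

open LatticeModels

/-- **Werner's Lemma 6.3 for the alternating `π̂` from alternating separation alone.** For every
small `ε` there is `r₁` such that for every `r₀ ≥ r₁` there are `n₁`, `δ > 0`, `0 < c`, `C` with
`c π̂^alt_{1/2}(r₀, N) ≤ π̂^alt_t(r₀, N) ≤ C π̂^alt_{1/2}(r₀, N)` for `1/2 ≤ t < 1/2 + δ`, `n₁ ≤ N`,
and `N ≤ L(t, ε)` if `t > 1/2` — `altFourArm_stability_of_altSeparation` with its a priori input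
discharged by `altFourArm_lowerBound`. [cite: WernerPCMI2009, Lecture 6, Lemma 6.3 with §3 (third a priori estimate) and §5] [cite: Nolin2008, §6.2 Thm. 27 for j = 4, σ = BWBW, with Thm. 11 and Thm. 24 (ii) (arXiv 0711.4948: Thm. 26, Thm. 10, Thm. 23 (ii))] -/
theorem altFourArm_stability_of_altSeparation'
    (hsepA : ∃ ε₁ > (0 : ℝ), ∀ ⦃ε : ℝ⦄, 0 < ε → ε < ε₁ →
      ∃ n₀ : ℕ, ∃ δ > (0 : ℝ), ∃ c > (0 : ℝ),
        ∀ t : unitInterval, 1 / 2 ≤ (t : ℝ) → (t : ℝ) < 1 / 2 + δ →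
          ∀ n N : ℕ, n₀ ≤ n → 2 * n ≤ N → (1 / 2 < (t : ℝ) → N ≤ charLengthW ε t) →
            c * altFourArmProbAt t n N ≤ (triSitePercolation t).real (sepFourArm n N)) :
    ∃ ε₁ > (0 : ℝ), ∀ ⦃ε : ℝ⦄, 0 < ε → ε < ε₁ →
      ∃ r₁ : ℕ, ∀ r₀ ≥ r₁, ∃ n₁ : ℕ, ∃ δ > (0 : ℝ), ∃ c > (0 : ℝ), ∃ C : ℝ,
        ∀ t : unitInterval, 1 / 2 ≤ (t : ℝ) → (t : ℝ) < 1 / 2 + δ →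
          ∀ N : ℕ, n₁ ≤ N → (1 / 2 < (t : ℝ) → N ≤ charLengthW ε t) →
            c * altFourArmProbAt half r₀ N ≤ altFourArmProbAt t r₀ N ∧
              altFourArmProbAt t r₀ N ≤ C * altFourArmProbAt half r₀ N :=
  altFourArm_stability_of_altSeparation hsepA altFourArm_lowerBound

/-- **The order-free `Werner2009_lemma63` from alternating separation and adjacent stability.**
Werner's Lemma 6.3 for the tree's `π̂_t = P_t(armEvent ![T,F,T,F] r₀ N)` (both cyclic
arrangements, `armEvent_four_eq_alt_union_adj`) follows from `hsepA` (whence the stability of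
the alternating arrangement, `altFourArm_stability_of_altSeparation'`) and the near-critical
stability of the adjacent arrangement `P_t(adjFourArm r₀ N) ≍ P_{1/2}(adjFourArm r₀ N)` below
`L(t, ε)` (Nolin's Thm. 27 for `σ = BBWW`), by the union bound
(`Werner2009_lemma63_of_altStability_of_adjStability`). [cite: WernerPCMI2009, Lecture 6, Lemma 6.3] [cite: Nolin2008, §6.2 Thm. 27 for j = 4 (both colour sequences, §4.1) (arXiv 0711.4948: Thm. 26)] -/
theorem Werner2009_lemma63_of_altSeparation_of_adjStability
    (hsepA : ∃ ε₁ > (0 : ℝ), ∀ ⦃ε : ℝ⦄, 0 < ε → ε < ε₁ →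
      ∃ n₀ : ℕ, ∃ δ > (0 : ℝ), ∃ c > (0 : ℝ),
        ∀ t : unitInterval, 1 / 2 ≤ (t : ℝ) → (t : ℝ) < 1 / 2 + δ →
          ∀ n N : ℕ, n₀ ≤ n → 2 * n ≤ N → (1 / 2 < (t : ℝ) → N ≤ charLengthW ε t) →
            c * altFourArmProbAt t n N ≤ (triSitePercolation t).real (sepFourArm n N))
    (hAdj : ∃ ε₁ > (0 : ℝ), ∀ ⦃ε : ℝ⦄, 0 < ε → ε < ε₁ →
      ∃ r₁ : ℕ, ∀ r₀ ≥ r₁, ∃ n₁ : ℕ, ∃ δ > (0 : ℝ), ∃ c > (0 : ℝ), ∃ C : ℝ,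
        ∀ t : unitInterval, 1 / 2 ≤ (t : ℝ) → (t : ℝ) < 1 / 2 + δ →
          ∀ N : ℕ, n₁ ≤ N → (1 / 2 < (t : ℝ) → N ≤ charLengthW ε t) →
            c * (triSitePercolation half).real (adjFourArm r₀ N) ≤
                (triSitePercolation t).real (adjFourArm r₀ N) ∧
              (triSitePercolation t).real (adjFourArm r₀ N) ≤
                C * (triSitePercolation half).real (adjFourArm r₀ N)) :
    Werner2009_lemma63 :=
  Werner2009_lemma63_of_altStability_of_adjStability (altFourArm_stability_of_altSeparation' hsepA)
    hAdj

end Literature.Probability.Percolation
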